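import Summits.Ventures.YMGap.Thresholds.SharpClusteringWeakGrad
import Summits.Ventures.YMGap.Thresholds.LatticeBakryEmeryGroundState
import HarnessLib

/-!
# Venture YMGap — static exponential clustering, Part II-c:
# the a-priori `H²` bound for the projections of an element of `H¹` orthogonal to `(1-Δ)(Δ-W)𝒫`

HONEST FRAMING: venture file (cell `pub-ymgap`, track (a), seat lit-1); continuation of
`SharpClusteringWeakGrad`. No physics and no number in this file.

Setting: `S ∈ 𝒫_d` a polynomial potential on `(E → M_N(ℂ))`, `W = ¼Γ(S,S) + ½ΔS` its Schrödinger
weight (`schW`), `A q = Δq - Wq` the ground-state-transformed generator on polynomials. Towards the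
`H¹`-density of `A𝒫` (Part II-d) we consider `z = (ψ, ζ) ∈ H¹` which is `𝓗`-orthogonal to `J(Aq)` for
every polynomial `q`; by the weak-gradient identity this says `∫ ((1-Δ)Aq)·ψ = 0` (`orth_iff`). Testing
with the polynomial representatives `p_n` of the `L²`-projections `ψ_n = P_nψ` and using
`(1-Δ)Δ𝒫_n ⊆ 𝒫_n` gives the **energy identity**
`∫Γ(p_n,p_n) + ∫(Δp_n)² = -∫ (Wp_n)ψ - ∑_a ∫ D_a(Wp_n) ζ_a` (`energy_identity`), whence the uniform
bounds `∫Γ(p_n,p_n) ≤ C`, `∫(Δp_n)² ≤ C` (`energy_bound`): the projections are bounded in `H²` — the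
finite-dimensional substitute for elliptic regularity, one Sobolev level above
`LatticeBakryEmeryProjection.exists_proj_seq`.

## References

* Tree file `SUNBakryEmeryPoincare.lean` Part G and venture file `LatticeBakryEmeryProjection.lean`
  (the projection argument at the `H¹` level, seat p2).
-/

noncomputable section

open scoped Matrix ComplexConjugate BigOperators Matrix.Norms.Frobenius ContDiff Topology InnerProductSpace
open Matrix Complex Finset MeasureTheory Filter
open Literature.MathematicalPhysics.QuantumFieldTheory

namespace Summit.Ventures.YMGap

namespace SharpClustering

open LatticeBakryEmery

universe u

variable {ι : Type u} [Fintype ι] [DecidableEq ι] {N : ℕ}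

/-! ### Symmetric integration by parts -/

/-- `∫ Δp · r dσ^{⊗E} = ∫ p · Δr dσ^{⊗E}`. -/
theorem integral_Lap_mul_comm (hN : N ≠ 0) {p r : Cfg ι N → ℝ} (hp : ContDiff ℝ ∞ p) (hr : ContDiff ℝ ∞ r) :
    ∫ g : PSU ι N, Lap p (emb g) * r (emb g) ∂(haarPi ι N) =
      ∫ g : PSU ι N, p (emb g) * Lap r (emb g) ∂(haarPi ι N) := by
  have h1 := integral_mul_Lap hN hr hp
  have h2 := integral_mul_Lap hN hp hr
  rw [Gam_comm] at h1
  have e : ∫ g : PSU ι N, Lap p (emb g) * r (emb g) ∂(haarPi ι N) =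
      ∫ g : PSU ι N, r (emb g) * Lap p (emb g) ∂(haarPi ι N) :=
    integral_congr_ae (ae_of_all _ fun g => mul_comm _ _)
  rw [e, h1, h2]

/-- The operator `1 - Δ` on ambient functions. -/
def oneSubLap (p : Cfg ι N → ℝ) : Cfg ι N → ℝ := fun Q => p Q - Lap p Q

/-- `(1-Δ)p` is smooth. -/
theorem contDiff_oneSubLap {p : Cfg ι N → ℝ} (hp : ContDiff ℝ ∞ p) : ContDiff ℝ ∞ (oneSubLap p) :=
  hp.sub (contDiff_Lap hp)

/-- `(1-Δ)𝒫_n ⊆ 𝒫_n`. -/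
theorem oneSubLap_mem_polySpace {n : ℕ} {p : Cfg ι N → ℝ} (hp : p ∈ polySpace ι N n) :
    oneSubLap p ∈ polySpace ι N n := by
  have : oneSubLap p = p - Lap p := rfl
  rw [this]
  exact Submodule.sub_mem _ hp (Lap_mem_polySpace hp)

/-- `∫ (1-Δ)p · r = ∫ p · (1-Δ)r`. -/
theorem integral_oneSubLap_mul_comm (hN : N ≠ 0) {p r : Cfg ι N → ℝ} (hp : ContDiff ℝ ∞ p)
    (hr : ContDiff ℝ ∞ r) :
    ∫ g : PSU ι N, oneSubLap p (emb g) * r (emb g) ∂(haarPi ι N) =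
      ∫ g : PSU ι N, p (emb g) * oneSubLap r (emb g) ∂(haarPi ι N) := by
  simp only [oneSubLap, sub_mul, mul_sub]
  have i1 : Integrable (fun g : PSU ι N => p (emb g) * r (emb g)) (haarPi ι N) :=
    integrable_of_continuous_PSU ((continuous_restrict hp).mul (continuous_restrict hr)) _
  have i2 : Integrable (fun g : PSU ι N => Lap p (emb g) * r (emb g)) (haarPi ι N) :=
    integrable_of_continuous_PSU ((continuous_restrict (contDiff_Lap hp)).mul (continuous_restrict hr)) _
  have i3 : Integrable (fun g : PSU ι N => p (emb g) * Lap r (emb g)) (haarPi ι N) :=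
    integrable_of_continuous_PSU ((continuous_restrict hp).mul (continuous_restrict (contDiff_Lap hr))) _
  rw [integral_sub i1 i2, integral_sub i1 i3, integral_Lap_mul_comm hN hp hr]

/-! ### The Schrödinger operator `A = Δ - W` on ambient functions -/

/-- `A q = Δq - W q`, `W = schW S` (the ground-state transform of `L_S`). -/
def schOp (S q : Cfg ι N → ℝ) : Cfg ι N → ℝ := fun Q => Lap q Q - schW S Q * q Q

/-- `A q = Δq - W q` as functions. -/
theorem schOp_eq (S q : Cfg ι N → ℝ) : schOp S q = Lap q - schW S * q := rfl

/-- `A q` is smooth. -/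
theorem contDiff_schOp {S q : Cfg ι N → ℝ} (hS : ContDiff ℝ ∞ S) (hq : ContDiff ℝ ∞ q) :
    ContDiff ℝ ∞ (schOp S q) :=
  (contDiff_Lap hq).sub ((contDiff_schW hS).mul hq)

/-- `A` maps polynomials to polynomials: `A𝒫_n ⊆ 𝒫_{n+2d}`. -/
theorem schOp_mem_polySpace {n dS : ℕ} {S : Cfg ι N → ℝ} (hS : S ∈ polySpace ι N dS) {q : Cfg ι N → ℝ}
    (hq : q ∈ polySpace ι N n) : schOp S q ∈ polySpace ι N (n + (dS + dS)) := by
  rw [schOp_eq]; exact Lap_sub_schW_mul_mem hS hq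

/-! ### Orthogonality to `J(A𝒫)` in terms of `ψ` alone -/

/-- For `z = (ψ, ζ) ∈ H¹` and smooth `s`: `⟪J s, z⟫ = ∫ (1-Δ)s · ψ`. -/
theorem inner_sobJ_eq_integral_oneSubLap (hN : N ≠ 0) {z : HSp ι N} (hz : z ∈ HOne ι N)
    {s : Cfg ι N → ℝ} (hs : ContDiff ℝ ∞ s) :
    ⟪sobJ s hs, z⟫_ℝ = ∫ g : PSU ι N, oneSubLap s (emb g) * z.fst g ∂(haarPi ι N) := by
  rw [inner_sobJ_left hs, ← neg_neg (∑ a, _), ← integral_Lap_mul_fst hN hz hs]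
  simp only [oneSubLap, sub_mul]
  rw [integral_sub (integrable_continuous_mul_L2 (continuous_restrict hs) _)
    (integrable_continuous_mul_L2 (continuous_restrict (contDiff_Lap hs)) _)]
  ring

/-! ### Sup norms of the weight on the compact group -/

omit [DecidableEq ι] in
/-- A continuous ambient function is bounded on `SU(N)^E`. -/
theorem exists_bound_restrict {F : Cfg ι N → ℝ} (hF : ContDiff ℝ ∞ F) :
    ∃ C : ℝ, 0 ≤ C ∧ ∀ g : PSU ι N, |F (emb g)| ≤ C := by
  obtain ⟨C, hC⟩ := (isCompact_univ (X := PSU ι N)).exists_bound_of_continuousOn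
    (continuous_restrict hF).continuousOn
  refine ⟨max C 0, le_max_right _ _, fun g => ?_⟩
  have := hC g (Set.mem_univ _)
  rw [Real.norm_eq_abs] at this
  exact this.trans (le_max_left _ _)

/-- `Γ(Wp, Wp) ≤ 2W² Γ(p,p) + 2p² Γ(W,W)` pointwise. -/
theorem Gam_mul_self_le {W p : Cfg ι N → ℝ} (hW : ContDiff ℝ ∞ W) (hp : ContDiff ℝ ∞ p) (Q : Cfg ι N) :
    Gam (W * p) (W * p) Q ≤ 2 * W Q ^ 2 * Gam p p Q + 2 * p Q ^ 2 * Gam W W Q := by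
  rw [Gam_self_eq_sum_sq, Gam_self_eq_sum_sq, Gam_self_eq_sum_sq, mul_sum, mul_sum, ← sum_add_distrib]
  refine sum_le_sum fun a _ => ?_
  rw [algD_mul hW hp]
  simp only [Pi.add_apply, Pi.mul_apply]
  nlinarith [sq_nonneg (W Q * algD (bframe a) p Q - p Q * algD (bframe a) W Q)]

/-! ### The energy identity and the `H²` bound for the projections -/

section Energy

omit [DecidableEq ι] in
/-- Representation of the projection `P_n ψ` by a polynomial and the transfer of inner products:
if `ψ_n = P_n ψ` is represented by `p ∈ 𝒫_n` then `⟪ψ, r⟫ = ∫ p r` for every `r ∈ 𝒫_n`. -/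
theorem inner_eq_integral_rep {ψ : Lp ℝ 2 (haarPi ι N)} {n : ℕ} {p : Cfg ι N → ℝ} (hp : p ∈ polySpace ι N n)
    (hrep : sL2 p (contDiff_of_mem_polySpace hp) = (VPoly ι N n).starProjection ψ)
    {r : Cfg ι N → ℝ} (hr : r ∈ polySpace ι N n) :
    ⟪ψ, sL2 r (contDiff_of_mem_polySpace hr)⟫_ℝ =
      ∫ g : PSU ι N, p (emb g) * r (emb g) ∂(haarPi ι N) := by
  have hmem : sL2 r (contDiff_of_mem_polySpace hr) ∈ VPoly ι N n := ⟨⟨r, hr⟩, rfl⟩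
  have h0 : ⟪ψ - (VPoly ι N n).starProjection ψ, sL2 r (contDiff_of_mem_polySpace hr)⟫_ℝ = 0 :=
    Submodule.starProjection_inner_eq_zero ψ _ hmem
  rw [inner_sub_left, sub_eq_zero] at h0
  rw [h0, ← hrep, inner_sL2_sL2]

/-- **The energy identity.** Let `z = (ψ, ζ) ∈ H¹` be orthogonal to `J(Aq)` for all polynomials `q`,
and let `p ∈ 𝒫_n` represent `P_nψ`. Then
`∫ Γ(p,p) + ∫ (Δp)² = -∫ (Wp)ψ - ∑_a ∫ D_a(Wp) ζ_a`. -/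
theorem energy_identity (hN : N ≠ 0) {dS : ℕ} {S : Cfg ι N → ℝ} (hSp : S ∈ polySpace ι N dS)
    {z : HSp ι N} (hz : z ∈ HOne ι N)
    (horth : ∀ (m : ℕ) (q : Cfg ι N → ℝ) (hq : q ∈ polySpace ι N m),
      ⟪sobJ (schOp S q) (contDiff_schOp (contDiff_of_mem_polySpace hSp) (contDiff_of_mem_polySpace hq)), z⟫_ℝ = 0)
    {n : ℕ} {p : Cfg ι N → ℝ} (hp : p ∈ polySpace ι N n)
    (hrep : sL2 p (contDiff_of_mem_polySpace hp) = (VPoly ι N n).starProjection z.fst) :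
    ∫ g : PSU ι N, Gam p p (emb g) ∂(haarPi ι N) + ∫ g : PSU ι N, Lap p (emb g) ^ 2 ∂(haarPi ι N) =
      -∫ g : PSU ι N, (schW S * p) (emb g) * z.fst g ∂(haarPi ι N) -
        ∑ a, ∫ g : PSU ι N, algD (bframe a) (schW S * p) (emb g) * z.snd a g ∂(haarPi ι N) := by
  have hS : ContDiff ℝ ∞ S := contDiff_of_mem_polySpace hSp
  have hpc : ContDiff ℝ ∞ p := contDiff_of_mem_polySpace hp
  have hWc : ContDiff ℝ ∞ (schW S) := contDiff_schW hS
  have hWp : ContDiff ℝ ∞ (schW S * p) := hWc.mul hpc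
  -- the orthogonality relation tested at `q = p`
  have h0 := horth n p hp
  rw [inner_sobJ_eq_integral_oneSubLap hN hz] at h0
  -- split `(1-Δ)(Δp - Wp) = (1-Δ)Δp - (1-Δ)(Wp)`
  have hsplit : ∀ g : PSU ι N, oneSubLap (schOp S p) (emb g) * z.fst g =
      oneSubLap (Lap p) (emb g) * z.fst g - oneSubLap (schW S * p) (emb g) * z.fst g := by
    intro g
    have : oneSubLap (schOp S p) (emb g) = oneSubLap (Lap p) (emb g) - oneSubLap (schW S * p) (emb g) := by
      simp only [oneSubLap, schOp_eq]
      rw [Lap_sub_apply (contDiff_Lap hpc) hWp]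
      simp only [Pi.sub_apply]
      ring
    rw [this]; ring
  rw [integral_congr_ae (ae_of_all _ hsplit), integral_sub
    (integrable_continuous_mul_L2 (continuous_restrict (contDiff_oneSubLap (contDiff_Lap hpc))) _)
    (integrable_continuous_mul_L2 (continuous_restrict (contDiff_oneSubLap hWp)) _)] at h0
  -- first piece: `(1-Δ)Δp ∈ 𝒫_n`, so `∫ (1-Δ)Δp · ψ = ∫ (1-Δ)Δp · p = -∫Γ(p,p) - ∫(Δp)²`
  have hmem : oneSubLap (Lap p) ∈ polySpace ι N n := oneSubLap_mem_polySpace (Lap_mem_polySpace hp)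
  have h1 : ∫ g : PSU ι N, oneSubLap (Lap p) (emb g) * z.fst g ∂(haarPi ι N) =
      -∫ g : PSU ι N, Gam p p (emb g) ∂(haarPi ι N) - ∫ g : PSU ι N, Lap p (emb g) ^ 2 ∂(haarPi ι N) := by
    have e1 : ∫ g : PSU ι N, oneSubLap (Lap p) (emb g) * z.fst g ∂(haarPi ι N) =
        ⟪z.fst, sL2 (oneSubLap (Lap p)) (contDiff_of_mem_polySpace hmem)⟫_ℝ := by
      rw [real_inner_comm, inner_sL2_left]
    rw [e1, inner_eq_integral_rep hp hrep hmem]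
    simp only [oneSubLap, mul_sub]
    have i1 : Integrable (fun g : PSU ι N => p (emb g) * Lap p (emb g)) (haarPi ι N) :=
      integrable_of_continuous_PSU ((continuous_restrict hpc).mul (continuous_restrict (contDiff_Lap hpc))) _
    have i2 : Integrable (fun g : PSU ι N => p (emb g) * Lap (Lap p) (emb g)) (haarPi ι N) :=
      integrable_of_continuous_PSU ((continuous_restrict hpc).mul
        (continuous_restrict (contDiff_Lap (contDiff_Lap hpc)))) _
    rw [integral_sub i1 i2, integral_mul_Lap hN hpc hpc, ← integral_Lap_mul_comm hN hpc (contDiff_Lap hpc)]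
    congr 1
    exact integral_congr_ae (ae_of_all _ fun g => by ring)
  -- second piece: `∫ (1-Δ)(Wp) · ψ = ∫ (Wp)ψ + ∑_a ∫ D_a(Wp) ζ_a`
  have h2 : ∫ g : PSU ι N, oneSubLap (schW S * p) (emb g) * z.fst g ∂(haarPi ι N) =
      ∫ g : PSU ι N, (schW S * p) (emb g) * z.fst g ∂(haarPi ι N) +
        ∑ a, ∫ g : PSU ι N, algD (bframe a) (schW S * p) (emb g) * z.snd a g ∂(haarPi ι N) := by
    simp only [oneSubLap, sub_mul]
    rw [integral_sub (integrable_continuous_mul_L2 (continuous_restrict hWp) _)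
      (integrable_continuous_mul_L2 (continuous_restrict (contDiff_Lap hWp)) _), integral_Lap_mul_fst hN hz hWp]
    ring
  rw [h1, h2] at h0
  linarith

/-- From `x ≤ a + b √x` with `a, b ≥ 0` to `x ≤ (b + √a)²`. -/
theorem le_sq_of_le_add_mul_sqrt {x a b : ℝ} (hx : 0 ≤ x) (ha : 0 ≤ a) (hb : 0 ≤ b)
    (h : x ≤ a + b * Real.sqrt x) : x ≤ (b + Real.sqrt a) ^ 2 := by
  by_contra hc
  push Not at hc
  have hs : b + Real.sqrt a < Real.sqrt x := by
    have := Real.sqrt_lt_sqrt (sq_nonneg _) hc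
    rwa [Real.sqrt_sq (by positivity)] at this
  have hsa : Real.sqrt a ≤ Real.sqrt x := by linarith [Real.sqrt_nonneg a]
  have hxx : Real.sqrt x * Real.sqrt x = x := Real.mul_self_sqrt hx
  have haa : Real.sqrt a * Real.sqrt a = a := Real.mul_self_sqrt ha
  -- `x = √x √x > (b + √a) √x = b√x + √a √x ≥ b √x + a`
  have h1 : (b + Real.sqrt a) * Real.sqrt x < Real.sqrt x * Real.sqrt x :=
    mul_lt_mul_of_pos_right hs (lt_of_le_of_lt (by positivity) hs)
  have h2 : Real.sqrt a * Real.sqrt a ≤ Real.sqrt a * Real.sqrt x :=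
    mul_le_mul_of_nonneg_left hsa (Real.sqrt_nonneg a)
  nlinarith [Real.sqrt_nonneg a, Real.sqrt_nonneg x]

omit [DecidableEq ι] in
/-- `∫ (Wp)² ≤ CW² ∫ p²` when `|W| ≤ CW` on `SU(N)^E`. -/
theorem integral_W_mul_sq_le {W p : Cfg ι N → ℝ} (hW : ContDiff ℝ ∞ W) (hp : ContDiff ℝ ∞ p) {CW : ℝ}
    (hCW : ∀ g : PSU ι N, |W (emb g)| ≤ CW) :
    ∫ g : PSU ι N, (W * p) (emb g) ^ 2 ∂(haarPi ι N) ≤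
      CW ^ 2 * ∫ g : PSU ι N, p (emb g) ^ 2 ∂(haarPi ι N) := by
  have hWp : ContDiff ℝ ∞ (W * p) := hW.mul hp
  rw [← integral_const_mul]
  refine integral_mono (integrable_of_continuous_PSU ((continuous_restrict hWp).pow 2) _)
    ((integrable_of_continuous_PSU ((continuous_restrict hp).pow 2) _).const_mul _) fun g => ?_
  show (W * p) (emb g) ^ 2 ≤ CW ^ 2 * p (emb g) ^ 2
  simp only [Pi.mul_apply, mul_pow]
  have h3 : W (emb g) ^ 2 ≤ CW ^ 2 := by
    rw [← sq_abs]; exact pow_le_pow_left₀ (abs_nonneg _) (hCW g) 2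
  exact mul_le_mul_of_nonneg_right h3 (sq_nonneg _)

omit [DecidableEq ι] in
/-- First error term: `|∫ (Wp) ψ| ≤ CW ‖p‖ ‖ψ‖`. -/
theorem abs_integral_W_mul_mul_le {W p : Cfg ι N → ℝ} (hW : ContDiff ℝ ∞ W) (hp : ContDiff ℝ ∞ p)
    {CW : ℝ} (hCW0 : 0 ≤ CW) (hCW : ∀ g : PSU ι N, |W (emb g)| ≤ CW) (ψ : Lp ℝ 2 (haarPi ι N)) :
    |∫ g : PSU ι N, (W * p) (emb g) * ψ g ∂(haarPi ι N)| ≤ CW * ‖sL2 p hp‖ * ‖ψ‖ := by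
  have hWp : ContDiff ℝ ∞ (W * p) := hW.mul hp
  rw [← inner_sL2_left hWp]
  refine (abs_real_inner_le_norm _ _).trans (mul_le_mul_of_nonneg_right ?_ (norm_nonneg _))
  have h2 : ‖sL2 (W * p) hWp‖ ^ 2 ≤ (CW * ‖sL2 p hp‖) ^ 2 := by
    rw [norm_sL2_sq, mul_pow, norm_sL2_sq]
    exact integral_W_mul_sq_le hW hp hCW
  exact (pow_le_pow_iff_left₀ (norm_nonneg _) (by positivity) two_ne_zero).mp h2

/-- `∫ Γ(Wp,Wp) ≤ 2 CW² ∫Γ(p,p) + 2 CG ∫ p²`. -/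
theorem integral_Gam_W_mul_le {W p : Cfg ι N → ℝ} (hW : ContDiff ℝ ∞ W) (hp : ContDiff ℝ ∞ p)
    {CW CG : ℝ} (hCW : ∀ g : PSU ι N, |W (emb g)| ≤ CW) (hCG : ∀ g : PSU ι N, |Gam W W (emb g)| ≤ CG) :
    ∫ g : PSU ι N, Gam (W * p) (W * p) (emb g) ∂(haarPi ι N) ≤
      2 * CW ^ 2 * ∫ g : PSU ι N, Gam p p (emb g) ∂(haarPi ι N) +
        2 * CG * ∫ g : PSU ι N, p (emb g) ^ 2 ∂(haarPi ι N) := by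
  have i1 : Integrable (fun g : PSU ι N => 2 * CW ^ 2 * Gam p p (emb g)) (haarPi ι N) :=
    (integrable_of_continuous_PSU (continuous_restrict (contDiff_Gam hp hp)) _).const_mul _
  have i2 : Integrable (fun g : PSU ι N => 2 * CG * p (emb g) ^ 2) (haarPi ι N) :=
    (integrable_of_continuous_PSU ((continuous_restrict hp).pow 2) _).const_mul _
  have hWp : ContDiff ℝ ∞ (W * p) := hW.mul hp
  rw [← integral_const_mul, ← integral_const_mul, ← integral_add i1 i2]
  refine integral_mono (integrable_of_continuous_PSU
    (continuous_restrict (contDiff_Gam hWp hWp)) _) (i1.add i2) fun g => ?_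
  show Gam (W * p) (W * p) (emb g) ≤ 2 * CW ^ 2 * Gam p p (emb g) + 2 * CG * p (emb g) ^ 2
  have h1 := Gam_mul_self_le hW hp (emb g)
  have h2 : W (emb g) ^ 2 ≤ CW ^ 2 := by
    rw [← sq_abs]; exact pow_le_pow_left₀ (abs_nonneg _) (hCW g) 2
  have h3 : Gam W W (emb g) ≤ CG := (le_abs_self _).trans (hCG g)
  have h4 := Gam_self_nonneg p (emb g)
  nlinarith [mul_le_mul_of_nonneg_right h2 h4, mul_le_mul_of_nonneg_left h3 (sq_nonneg (p (emb g)))]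

/-- Second error term: `|∑_a ∫ D_a F ζ_a| ≤ (∫Γ(F,F))^{1/2} ‖z‖`. -/
theorem abs_sum_integral_algD_mul_snd_le {F : Cfg ι N → ℝ} (hF : ContDiff ℝ ∞ F) (z : HSp ι N) :
    |∑ a, ∫ g : PSU ι N, algD (bframe a) F (emb g) * z.snd a g ∂(haarPi ι N)| ≤
      Real.sqrt (∫ g : PSU ι N, Gam F F (emb g) ∂(haarPi ι N)) * ‖z‖ := by
  have hcs := Real.sum_mul_le_sqrt_mul_sqrt univ
    (fun a : BIdx ι N => ‖sL2 (algD (bframe a) F) (contDiff_algD hF _)‖) (fun a => ‖z.snd a‖)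
  have hsum1 : ∑ a : BIdx ι N, ‖sL2 (algD (bframe a) F) (contDiff_algD hF _)‖ ^ 2 =
      ∫ g : PSU ι N, Gam F F (emb g) ∂(haarPi ι N) := by
    simp only [norm_sL2_sq]
    have i1 : ∀ a : BIdx ι N,
        Integrable (fun g : PSU ι N => algD (bframe a) F (emb g) ^ 2) (haarPi ι N) :=
      fun a => integrable_of_continuous_PSU ((continuous_restrict (contDiff_algD hF _)).pow 2) _
    rw [← integral_finsetSum _ fun a _ => i1 a]
    exact integral_congr_ae (ae_of_all _ fun g => (Gam_self_eq_sum_sq _ _).symm)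
  have hsum2 : ∑ a : BIdx ι N, ‖z.snd a‖ ^ 2 ≤ ‖z‖ ^ 2 := sum_norm_snd_sq_le z
  calc |∑ a, ∫ g : PSU ι N, algD (bframe a) F (emb g) * z.snd a g ∂(haarPi ι N)|
      ≤ ∑ a, |∫ g : PSU ι N, algD (bframe a) F (emb g) * z.snd a g ∂(haarPi ι N)| :=
        abs_sum_le_sum_abs _ _
    _ ≤ ∑ a : BIdx ι N, ‖sL2 (algD (bframe a) F) (contDiff_algD hF _)‖ * ‖z.snd a‖ := by
        refine sum_le_sum fun a _ => ?_
        rw [← inner_sL2_left]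
        exact abs_real_inner_le_norm _ _
    _ ≤ Real.sqrt (∑ a : BIdx ι N, ‖sL2 (algD (bframe a) F) (contDiff_algD hF _)‖ ^ 2) *
          Real.sqrt (∑ a : BIdx ι N, ‖z.snd a‖ ^ 2) := hcs
    _ ≤ Real.sqrt (∫ g : PSU ι N, Gam F F (emb g) ∂(haarPi ι N)) * ‖z‖ := by
        rw [hsum1]
        refine mul_le_mul_of_nonneg_left ?_ (Real.sqrt_nonneg _)
        calc Real.sqrt (∑ a : BIdx ι N, ‖z.snd a‖ ^ 2) ≤ Real.sqrt (‖z‖ ^ 2) := Real.sqrt_le_sqrt hsum2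
          _ = ‖z‖ := Real.sqrt_sq (norm_nonneg _)

/-- From `E + D ≤ a₀ + b₀ √E` (all nonnegative) to explicit bounds on `E` and `D`. -/
theorem le_of_energy_ineq {E D a₀ b₀ : ℝ} (hE : 0 ≤ E) (hD : 0 ≤ D) (ha : 0 ≤ a₀) (hb : 0 ≤ b₀)
    (h : E + D ≤ a₀ + b₀ * Real.sqrt E) :
    E ≤ (b₀ + Real.sqrt a₀) ^ 2 + (a₀ + b₀ * (b₀ + Real.sqrt a₀)) ∧
      D ≤ (b₀ + Real.sqrt a₀) ^ 2 + (a₀ + b₀ * (b₀ + Real.sqrt a₀)) := by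
  have hEb : E ≤ (b₀ + Real.sqrt a₀) ^ 2 := le_sq_of_le_add_mul_sqrt hE ha hb (by linarith)
  have hsE : Real.sqrt E ≤ b₀ + Real.sqrt a₀ := by
    have := Real.sqrt_le_sqrt hEb
    rwa [Real.sqrt_sq (by positivity)] at this
  have h6 : b₀ * Real.sqrt E ≤ b₀ * (b₀ + Real.sqrt a₀) := mul_le_mul_of_nonneg_left hsE hb
  have h7 : 0 ≤ b₀ * (b₀ + Real.sqrt a₀) := by positivity
  constructor <;> nlinarith [sq_nonneg (b₀ + Real.sqrt a₀)]

/-- The real-variable heart of the `H²` bound: a constant depending on `CW, CG, ‖ψ‖, ‖z‖` only. -/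
theorem exists_energy_const {CW CG nψ nz : ℝ} (hCW : 0 ≤ CW) (hCG : 0 ≤ CG) (hnψ : 0 ≤ nψ)
    (hnz : 0 ≤ nz) : ∃ C : ℝ, 0 ≤ C ∧ ∀ E D I₁ I₂ : ℝ, 0 ≤ E → 0 ≤ D → E + D = -I₁ - I₂ →
      |I₁| ≤ CW * nψ * nψ → |I₂| ≤ Real.sqrt (2 * CW ^ 2 * E + 2 * CG * nψ ^ 2) * nz → E ≤ C ∧ D ≤ C := by
  have ha0 : 0 ≤ CW * nψ * nψ + Real.sqrt (2 * CG) * nψ * nz := by positivity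
  have hb0 : 0 ≤ Real.sqrt 2 * CW * nz := by positivity
  refine ⟨(Real.sqrt 2 * CW * nz + Real.sqrt (CW * nψ * nψ + Real.sqrt (2 * CG) * nψ * nz)) ^ 2 +
      ((CW * nψ * nψ + Real.sqrt (2 * CG) * nψ * nz) + Real.sqrt 2 * CW * nz *
        (Real.sqrt 2 * CW * nz + Real.sqrt (CW * nψ * nψ + Real.sqrt (2 * CG) * nψ * nz))),
    by positivity, fun E D I₁ I₂ hE hD hid h1 h2 => le_of_energy_ineq hE hD ha0 hb0 ?_⟩
  -- `√(2CW²E + 2CG nψ²) ≤ √2 CW √E + √(2CG) nψ`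
  have t3 : Real.sqrt (2 * CW ^ 2 * E + 2 * CG * nψ ^ 2) ≤
      Real.sqrt 2 * CW * Real.sqrt E + Real.sqrt (2 * CG) * nψ := by
    have hx : 0 ≤ 2 * CW ^ 2 * E := by positivity
    have hy : 0 ≤ 2 * CG * nψ ^ 2 := by positivity
    have e1 : Real.sqrt (2 * CW ^ 2 * E) = Real.sqrt 2 * CW * Real.sqrt E := by
      rw [Real.sqrt_mul (by positivity : (0 : ℝ) ≤ 2 * CW ^ 2), Real.sqrt_mul (by norm_num : (0 : ℝ) ≤ 2),
        Real.sqrt_sq hCW]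
    have e2 : Real.sqrt (2 * CG * nψ ^ 2) = Real.sqrt (2 * CG) * nψ := by
      rw [Real.sqrt_mul (by positivity : (0 : ℝ) ≤ 2 * CG), Real.sqrt_sq hnψ]
    rw [← e1, ← e2, Real.sqrt_le_iff]
    refine ⟨by positivity, ?_⟩
    nlinarith [Real.mul_self_sqrt hx, Real.mul_self_sqrt hy, Real.sqrt_nonneg (2 * CW ^ 2 * E),
      Real.sqrt_nonneg (2 * CG * nψ ^ 2)]
  have h4 : Real.sqrt (2 * CW ^ 2 * E + 2 * CG * nψ ^ 2) * nz ≤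
      (Real.sqrt 2 * CW * Real.sqrt E + Real.sqrt (2 * CG) * nψ) * nz :=
    mul_le_mul_of_nonneg_right t3 hnz
  nlinarith [neg_le_abs I₁, neg_le_abs I₂]

/-- **The `H²` bound.** Under the hypotheses of `energy_identity` there is a constant `C` (depending
on `S` and `z` only) with `∫ Γ(p,p) ≤ C` and `∫ (Δp)² ≤ C` for the representative `p` of EVERY
projection `P_nψ`. -/
theorem energy_bound (hN : N ≠ 0) {dS : ℕ} {S : Cfg ι N → ℝ} (hSp : S ∈ polySpace ι N dS)
    {z : HSp ι N} (hz : z ∈ HOne ι N)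
    (horth : ∀ (m : ℕ) (q : Cfg ι N → ℝ) (hq : q ∈ polySpace ι N m),
      ⟪sobJ (schOp S q) (contDiff_schOp (contDiff_of_mem_polySpace hSp) (contDiff_of_mem_polySpace hq)), z⟫_ℝ = 0) :
    ∃ C : ℝ, 0 ≤ C ∧ ∀ (n : ℕ) (p : Cfg ι N → ℝ) (hp : p ∈ polySpace ι N n),
      sL2 p (contDiff_of_mem_polySpace hp) = (VPoly ι N n).starProjection z.fst →
        ∫ g : PSU ι N, Gam p p (emb g) ∂(haarPi ι N) ≤ C ∧
          ∫ g : PSU ι N, Lap p (emb g) ^ 2 ∂(haarPi ι N) ≤ C := by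
  have hS : ContDiff ℝ ∞ S := contDiff_of_mem_polySpace hSp
  have hWc : ContDiff ℝ ∞ (schW S) := contDiff_schW hS
  obtain ⟨CW, hCW0, hCW⟩ := exists_bound_restrict (ι := ι) hWc
  obtain ⟨CG, hCG0, hCG⟩ := exists_bound_restrict (ι := ι) (contDiff_Gam hWc hWc)
  obtain ⟨C, hC0, hC⟩ := exists_energy_const hCW0 hCG0 (norm_nonneg z.fst) (norm_nonneg z)
  refine ⟨C, hC0, fun n p hp hrep => ?_⟩
  have hpc : ContDiff ℝ ∞ p := contDiff_of_mem_polySpace hp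
  have hWp : ContDiff ℝ ∞ (schW S * p) := hWc.mul hpc
  have hpn : ‖sL2 p hpc‖ ≤ ‖z.fst‖ := by
    rw [hrep]; exact Submodule.norm_starProjection_apply_le _ _
  have hpn2 : ∫ g : PSU ι N, p (emb g) ^ 2 ∂(haarPi ι N) ≤ ‖z.fst‖ ^ 2 := by
    rw [← norm_sL2_sq hpc]; exact pow_le_pow_left₀ (norm_nonneg _) hpn 2
  refine hC _ _ _ _ (integral_nonneg fun g => Gam_self_nonneg _ _) (integral_nonneg fun g => sq_nonneg _)
    (energy_identity hN hSp hz horth hp hrep) ?_ ?_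
  · refine (abs_integral_W_mul_mul_le hWc hpc hCW0 hCW z.fst).trans ?_
    exact mul_le_mul_of_nonneg_right (mul_le_mul_of_nonneg_left hpn hCW0) (norm_nonneg _)
  · refine (abs_sum_integral_algD_mul_snd_le hWp z).trans
      (mul_le_mul_of_nonneg_right (Real.sqrt_le_sqrt ?_) (norm_nonneg _))
    refine (integral_Gam_W_mul_le hWc hpc hCW hCG).trans ?_
    nlinarith

end Energy

end SharpClustering

end Summit.Ventures.YMGap
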